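import Summits.QuantumFields.QCD.Theorems.RobustYangMillsRG.Negative.WildBlockingRest
import HarnessLib

/-!
# `RobustYangMillsRG` — negative side: the wild blocking map pushes product Haar to product Haar (W1)

Support for the disproof of the crux `RobustYangMillsRG` (stmt-QuantumFields-14958). For the wild
blocking map `bl` of `WildBlocking` (parts C₃/C₄ of the standing disprover: `blEdge_eq_first_mul_rest`,
`blRest_congr`), the image of the product Haar probability measure of the fine torus
`(ℤ/N)⁴` is the product Haar probability measure of the block torus `(ℤ/M)⁴` (`M b ≤ N`, `3 ≤ b`).
Proof by Haar uniqueness, as for the tree's `map_unevenAxialLink_torusLinkHaar`: left-multiplying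
the FIRST path links by a block field `h` (the lift `Function.extend (firstEdge N) h 1`)
multiplies `bl` on the left by `h` (`bl_extend_firstEdge_mul`), and product Haar on the fine torus is
invariant under that fixed left translation; so the image is a left-invariant probability measure
on the compact group `SU(3)^{links(M)}`, i.e. THE Haar probability measure, as is the product. [folklore]
-/

noncomputable section

namespace Summit.QuantumFields.QCD.Theorems.RobustYangMillsRG.Negative

open MeasureTheory Literature.MathematicalPhysics.QuantumFieldTheory

variable {N M b : ℕ} [NeZero N] [NeZero M]

/-! The **first-link lift** of a block field `h` is the fine field `Function.extend (firstEdge N) h 1`: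
equal to `h c` on the first path link `firstEdge c` of each block link `c` and to `1` on every
other fine link (kept inline, no new definition). -/

omit [NeZero N] in
/-- The first-link lift takes the value `h c` on the first link of `c` (`M b ≤ N`, `1 ≤ b`). [folklore] -/
theorem extend_firstEdge_apply (hMb : M * b ≤ N) (hb : 1 ≤ b) (h : GaugeConfig 4 M SU3)
    (c : Edge 4 M) : Function.extend (firstEdge (M := M) N) h 1 (firstEdge N c) = h c :=
  (firstEdge_injective hMb hb).extend_apply _ _ _

omit [NeZero N] [NeZero M] in
/-- The first-link lift is `1` off the first links. [folklore] -/
theorem extend_firstEdge_of_not_mem (h : GaugeConfig 4 M SU3) {e : Edge 4 N}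
    (he : e ∉ Set.range (firstEdge (M := M) N)) :
    Function.extend (firstEdge (M := M) N) h (1 : GaugeConfig 4 N SU3) e = 1 := by
  rw [Function.extend_apply' _ _ _ fun ⟨c, hc⟩ => he ⟨c, hc⟩, Pi.one_apply]

/-- **Left-multiplying the first links multiplies the blocked field on the left**:
`bl (lift h · U) = h · bl U` for the first-link lift (`M b ≤ N`, `3 ≤ b`). [folklore] -/
theorem bl_extend_firstEdge_mul (hMb : M * b ≤ N) (hb : 3 ≤ b) (h : GaugeConfig 4 M SU3)
    (U : GaugeConfig 4 N SU3) :
    bl (Function.extend (firstEdge (M := M) N) h 1 * U) = h * bl (M := M) U := by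
  funext c
  rw [Pi.mul_apply, blEdge_eq_first_mul_rest hMb (by omega) c,
    blEdge_eq_first_mul_rest hMb (by omega) c, Pi.mul_apply, extend_firstEdge_apply hMb (by omega),
    mul_assoc, blRest_congr hMb hb c (U := Function.extend (firstEdge (M := M) N) h 1 * U) (V := U)
      fun e he => ?_]
  rw [Pi.mul_apply, extend_firstEdge_of_not_mem h he, one_mul]

/-- **(W1) The wild blocking map pushes product Haar measure to product Haar measure**
(`M b ≤ N`, `3 ≤ b`): the block links of a Haar-distributed fine field are independent and Haar
distributed. [folklore] -/
theorem map_bl_pi_haarProbability (hMb : M * b ≤ N) (hb : 3 ≤ b) :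
    (Measure.pi fun _ : Edge 4 N => haarProbability SU3).map (bl (M := M)) =
      Measure.pi fun _ : Edge 4 M => haarProbability SU3 := by
  have hΦ : Measurable (bl (N := N) (M := M)) := measurable_bl
  set ν : Measure (GaugeConfig 4 M SU3) :=
    (Measure.pi fun _ : Edge 4 N => haarProbability SU3).map (bl (M := M)) with hν
  haveI : IsProbabilityMeasure ν := Measure.isProbabilityMeasure_map hΦ.aemeasurable
  haveI : ν.IsMulLeftInvariant := by
    refine ⟨fun h => ?_⟩
    rw [hν, Measure.map_map (measurable_const_mul h) hΦ]
    have hcomm : (fun V : GaugeConfig 4 M SU3 => h * V) ∘ bl =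
        bl ∘ fun U : GaugeConfig 4 N SU3 => Function.extend (firstEdge (M := M) N) h 1 * U :=
      funext fun U => (bl_extend_firstEdge_mul hMb hb h U).symm
    rw [hcomm, ← Measure.map_map hΦ (measurable_const_mul _), map_mul_left_eq_self]
  have h1 : ν = ν (⊤ : TopologicalSpace.PositiveCompacts (GaugeConfig 4 M SU3)) •
      Measure.haarMeasure ⊤ :=
    Measure.haarMeasure_unique ν ⊤
  have h2 : (Measure.pi fun _ : Edge 4 M => haarProbability SU3) =
      (Measure.pi fun _ : Edge 4 M => haarProbability SU3)
          (⊤ : TopologicalSpace.PositiveCompacts (GaugeConfig 4 M SU3)) •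
        Measure.haarMeasure ⊤ :=
    Measure.haarMeasure_unique _ ⊤
  rw [h1, h2, TopologicalSpace.PositiveCompacts.coe_top, measure_univ, measure_univ]

/-- Integrals of functions of the blocked field against product Haar measure of the fine torus
are product-Haar integrals on the block torus. [folklore] -/
theorem integral_comp_bl (hMb : M * b ≤ N) (hb : 3 ≤ b) {f : GaugeConfig 4 M SU3 → ℝ}
    (hf : Measurable f) :
    ∫ U, f (bl U) ∂(Measure.pi fun _ : Edge 4 N => haarProbability SU3) =
      ∫ V, f V ∂(Measure.pi fun _ : Edge 4 M => haarProbability SU3) := by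
  rw [← map_bl_pi_haarProbability (N := N) (M := M) hMb hb,
    integral_map measurable_bl.aemeasurable hf.aestronglyMeasurable]

end Summit.QuantumFields.QCD.Theorems.RobustYangMillsRG.Negative

end
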